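import Mathlib
import HarnessLib
import Summits.HubbardSuperconductivity.HubbardSuperconductivity.Theorems.KLProgrammeAbsUmklappTargetCountBound

/-!
# Route `KLProgramme` — K3 engine (stmt-HubbardSuperconductivity-20437), stub (b) (ℓ)/(I2)–(I3), located item «ABS-UMK-COUNT»:
# the bound of `card_targetStrings_prescribed_le` is `≤ c^L · 2^{n′(L−|E|−2)}` — pure arithmetic, prescribed-set version

Cell gate-hubbard-kl, seat p4 g16 (prescribed-set twin of `…AbsUmklappTargetCountBound`, p621451).  The headline
`AbsUmklappCount.card_targetStrings_prescribed_le` bounds the absolute count of target strings with a prescribed leg set of size `F` (`F + 5 ≤ L`) by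
`2L⁴·T_bound·N·K₀^{L−(F+4)} + L²2^L·L²·B_fib·(3·2^{n′})^{L−F−2}`.  With `t = 2^{n′}` this closed term is at most
`(128(Φ₀+1)(4E₁+1) + 384(a₆+1))^L · 2^{n′(L−F−2)}` (same constant as the anchored version); in the coarse regime `t ≤ Q·L` the trivial count of the
free legs `N^{L−F} = (2t)^{L−F}` is at most `(8(Q²+1))^L · t^{L−F−2}`:

* `card_prescribed_le` — `Nat.card {ω : Fin L → Fin N | ω|_E = τ|_E ∧ P ω} ≤ N^{L − |E|}`;
* `coarse_bound_prescribed` — `(2t)^{L−F} ≤ (8(Q²+1))^L · t^{L−F−2}` for `1 ≤ t ≤ Q·L`, `F + 2 ≤ L`;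
* **`targetBound_prescribed_le_pow`** — the rewriting above (`F + 5 ≤ L`).

Everything is PROVED; no definitions, no named facts; arithmetic only. [folklore]
-/

noncomputable section

open Real Set
open Literature.MathematicalPhysics.QuantumLattice

namespace Summit.HubbardSuperconductivity.HubbardSuperconductivity.Theorems.AbsUmklappCount

set_option linter.dupNamespace false -- summit = problem name (single-conjunct summit), D-0017

/-- **Strings with prescribed values on `E`**: whatever the further constraint `P`, their number is at most `N^{L − |E|}` (restriction to the
complement of `E` is injective). [folklore] -/
theorem card_prescribed_le {L N : ℕ} (E : Finset (Fin L)) (τ : Fin L → Fin N) (P : (Fin L → Fin N) → Prop) :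
    Nat.card {ω : Fin L → Fin N | (∀ e ∈ E, ω e = τ e) ∧ P ω} ≤ N ^ (L - E.card) := by
  classical
  set S : Set (Fin L → Fin N) := {ω : Fin L → Fin N | (∀ e ∈ E, ω e = τ e) ∧ P ω} with hS
  have hf : Function.Injective (fun ω : S => fun i : (Eᶜ : Finset (Fin L)) => ω.1 i) := by
    rintro ⟨ω, hω⟩ ⟨ω', hω'⟩ h
    apply Subtype.ext
    funext i
    by_cases hi : i ∈ E
    · exact (hω.1 i hi).trans (hω'.1 i hi).symm
    · exact congrFun h ⟨i, Finset.mem_compl.2 hi⟩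
  have h1 := Nat.card_le_card_of_injective _ hf
  have h2 : Nat.card ((Eᶜ : Finset (Fin L)) → Fin N) = N ^ (L - E.card) := by
    rw [Nat.card_eq_fintype_card, Fintype.card_fun, Fintype.card_fin, Fintype.card_coe, Finset.card_compl, Fintype.card_fin]
  rwa [h2] at h1

/-- The coarse case, prescribed-set version: `(2t)^{L−F} ≤ (8(Q² + 1))^L · t^{L−F−2}` when `1 ≤ t ≤ Q·L`, `F + 2 ≤ L`. [folklore] -/
theorem coarse_bound_prescribed {L F : ℕ} (hL : F + 2 ≤ L) {t Q : ℝ} (ht : 1 ≤ t) (htQ : t ≤ Q * L) :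
    (2 * t) ^ (L - F) ≤ (8 * (Q ^ 2 + 1)) ^ L * t ^ (L - F - 2) := by
  have ht0 : 0 < t := by linarith
  have hL1 : 1 ≤ L := by omega
  have hL2 : (L : ℝ) ^ 2 ≤ (4 : ℝ) ^ L := by
    have h1 : (L : ℝ) ≤ (2 : ℝ) ^ L := by exact_mod_cast (Nat.lt_two_pow_self (n := L)).le
    calc (L : ℝ) ^ 2 ≤ ((2 : ℝ) ^ L) ^ 2 := pow_le_pow_left₀ (Nat.cast_nonneg _) h1 2
      _ = (4 : ℝ) ^ L := by rw [← pow_mul, mul_comm, pow_mul]; norm_num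
  have h1 : (2 * t) ^ (L - F) = 2 ^ (L - F) * t ^ 2 * t ^ (L - F - 2) := by
    rw [mul_pow, mul_assoc, ← pow_add]; congr 2; omega
  have h2 : t ^ 2 ≤ Q ^ 2 * (4 : ℝ) ^ L := by
    calc t ^ 2 ≤ (Q * L) ^ 2 := pow_le_pow_left₀ ht0.le htQ 2
      _ = Q ^ 2 * (L : ℝ) ^ 2 := by rw [mul_pow]
      _ ≤ Q ^ 2 * (4 : ℝ) ^ L := mul_le_mul_of_nonneg_left hL2 (by positivity)
  have h3 : Q ^ 2 ≤ (Q ^ 2 + 1) ^ L := le_add_one_pow (by positivity) hL1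
  have h4 : (2 : ℝ) ^ (L - F) ≤ 2 ^ L := pow_le_pow_right₀ (by norm_num) (by omega)
  rw [h1]
  calc (2 : ℝ) ^ (L - F) * t ^ 2 * t ^ (L - F - 2) ≤ 2 ^ L * (Q ^ 2 * 4 ^ L) * t ^ (L - F - 2) := by
        exact mul_le_mul_of_nonneg_right (mul_le_mul h4 h2 (by positivity) (by positivity)) (by positivity)
    _ ≤ 2 ^ L * ((Q ^ 2 + 1) ^ L * 4 ^ L) * t ^ (L - F - 2) := by
        exact mul_le_mul_of_nonneg_right (mul_le_mul_of_nonneg_left (mul_le_mul_of_nonneg_right h3 (by positivity)) (by positivity))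
          (by positivity)
    _ = (8 * (Q ^ 2 + 1)) ^ L * t ^ (L - F - 2) := by
        rw [mul_pow]
        have h8 : (8 : ℝ) ^ L = 2 ^ L * 4 ^ L := by rw [← mul_pow]; norm_num
        rw [h8]; ring

set_option maxHeartbeats 800000 in -- one long chain of explicit inequalities on a large closed term (as in `targetBound_le_pow`)
/-- **The bound of `card_targetStrings_prescribed_le` in Lemma-3.1 shape.**  For `F + 5 ≤ L` (`F` = the number of prescribed legs), positive constants
and `B_fib ≤ a₆L²`, the closed bound is `≤ (128(Φ₀+1)(4E₁+1) + 384(a₆+1))^L · 2^{n′(L−F−2)}`,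
`E₁ = (16c₃/(s₁π) + 1)·(3840A_f(8c₃(1+B_f) + (4B_f+1)s₁π/2)/(c_f²s₁²π²))`. [folklore] -/
theorem targetBound_prescribed_le_pow {L n' F : ℕ} (hL : F + 5 ≤ L) {c₃ s₁ cf Af Bf Φ₀ Bfib a₆ : ℝ} (hc₃ : 0 < c₃) (hs₁ : 0 < s₁)
    (hcf : 0 < cf) (hAf : 0 < Af) (hBf : 0 ≤ Bf) (hΦ₀ : 0 ≤ Φ₀) (ha₆ : 0 ≤ a₆) (hBfib : Bfib ≤ a₆ * (L : ℝ) ^ 2) :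
    2 * (L : ℝ) ^ 4 *
        ((2 * (L * (4 * c₃ * (2 : ℝ) ^ (-(n' : ℤ)))) / (s₁ / 2 * sectorWidth n') + 1) *
          (960 * Af * (2 * (L * (4 * c₃ * (2 : ℝ) ^ (-(n' : ℤ))) + Bf * (L * (4 * c₃ * (2 : ℝ) ^ (-(n' : ℤ))))) +
            (4 * Bf + 1) * (s₁ / 2 * sectorWidth n')) / cf ^ 2 / (s₁ / 2 * sectorWidth n') ^ 2) *
        ((sectorCount n' : ℝ) * (2 * (2 * Φ₀ / sectorWidth n' + 1)) ^ (L - (F + 4)))) +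
      (L : ℝ) ^ 2 * 2 ^ L * (L ^ 2 * (Bfib * (3 * (2 : ℝ) ^ n') ^ (L - F - 2))) ≤
      (128 * (Φ₀ + 1) * (4 * ((16 * c₃ / (s₁ * π) + 1) * (3840 * Af * (8 * c₃ * (1 + Bf) + (4 * Bf + 1) * s₁ * π / 2) / (cf ^ 2 * s₁ ^ 2 * π ^ 2))) + 1) +
        384 * (a₆ + 1)) ^ L * (2 : ℝ) ^ (n' * (L - F - 2)) := by
  have hπ := Real.pi_pos
  have hπ3 := Real.pi_gt_three
  set t : ℝ := (2 : ℝ) ^ n' with ht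
  have ht1 : 1 ≤ t := one_le_pow₀ (by norm_num)
  have ht0 : 0 < t := by positivity
  have hL1 : (1 : ℝ) ≤ L := by exact_mod_cast (show 1 ≤ L by omega)
  have hL0 : (0 : ℝ) < L := by linarith
  set E₁ : ℝ := (16 * c₃ / (s₁ * π) + 1) * (3840 * Af * (8 * c₃ * (1 + Bf) + (4 * Bf + 1) * s₁ * π / 2) / (cf ^ 2 * s₁ ^ 2 * π ^ 2)) with hE₁
  have hE₁0 : 0 ≤ E₁ := by rw [hE₁]; positivity
  -- closed forms
  have hw : sectorWidth n' = π / t := sectorWidth_eq_pi_div_pow n'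
  have hN : (sectorCount n' : ℝ) = 2 * t := sectorCount_eq_two_mul_pow n'
  have hz : (2 : ℝ) ^ (-(n' : ℤ)) = t⁻¹ := two_zpow_neg_eq_inv_pow n'
  rw [hw, hN, hz]
  have e1 : 2 * (L * (4 * c₃ * t⁻¹)) / (s₁ / 2 * (π / t)) = 16 * L * c₃ / (s₁ * π) := by
    field_simp
    ring
  have e2 : 960 * Af * (2 * (L * (4 * c₃ * t⁻¹) + Bf * (L * (4 * c₃ * t⁻¹))) + (4 * Bf + 1) * (s₁ / 2 * (π / t))) / cf ^ 2 /
      (s₁ / 2 * (π / t)) ^ 2 = 3840 * Af * (8 * L * c₃ * (1 + Bf) + (4 * Bf + 1) * s₁ * π / 2) / (cf ^ 2 * s₁ ^ 2 * π ^ 2) * t := by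
    field_simp
    ring
  have e3 : 2 * (2 * Φ₀ / (π / t) + 1) = 2 * (2 * Φ₀ * t / π + 1) := by
    field_simp
  rw [e1, e2, e3]
  -- the cone count factor `K ≤ 2(Φ₀+1)t`
  set K : ℝ := 2 * (2 * Φ₀ * t / π + 1) with hK
  have hK0 : 0 ≤ K := by rw [hK]; positivity
  have hKle : K ≤ 2 * (Φ₀ + 1) * t := by
    have h1 : 2 * Φ₀ * t / π ≤ Φ₀ * t := by
      rw [div_le_iff₀ hπ]; nlinarith [mul_nonneg hΦ₀ ht0.le]
    rw [hK]; nlinarith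
  have hKpow : K ^ (L - (F + 4)) ≤ (2 * (Φ₀ + 1)) ^ (L - (F + 4)) * t ^ (L - (F + 4)) := by
    rw [← mul_pow]; exact pow_le_pow_left₀ hK0 hKle _
  -- the fibre factor `E(L)·t ≤ E₁ L² t`
  have hEL : (16 * L * c₃ / (s₁ * π) + 1) * (3840 * Af * (8 * L * c₃ * (1 + Bf) + (4 * Bf + 1) * s₁ * π / 2) / (cf ^ 2 * s₁ ^ 2 * π ^ 2) * t)
      ≤ E₁ * (L : ℝ) ^ 2 * t := by
    have h1 : 16 * L * c₃ / (s₁ * π) + 1 ≤ (16 * c₃ / (s₁ * π) + 1) * L := by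
      have : 0 ≤ 16 * c₃ / (s₁ * π) := by positivity
      have e : 16 * L * c₃ / (s₁ * π) = 16 * c₃ / (s₁ * π) * L := by ring
      rw [e]; nlinarith
    have h2 : 3840 * Af * (8 * L * c₃ * (1 + Bf) + (4 * Bf + 1) * s₁ * π / 2) / (cf ^ 2 * s₁ ^ 2 * π ^ 2) ≤
        3840 * Af * (8 * c₃ * (1 + Bf) + (4 * Bf + 1) * s₁ * π / 2) / (cf ^ 2 * s₁ ^ 2 * π ^ 2) * L := by
      rw [← mul_div_right_comm, div_le_div_iff_of_pos_right (by positivity)]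
      have h3 : 8 * L * c₃ * (1 + Bf) + (4 * Bf + 1) * s₁ * π / 2 ≤ (8 * c₃ * (1 + Bf) + (4 * Bf + 1) * s₁ * π / 2) * L := by
        have : 0 ≤ (4 * Bf + 1) * s₁ * π / 2 := by positivity
        nlinarith
      nlinarith [hAf.le]
    have h10 : 0 ≤ 16 * L * c₃ / (s₁ * π) + 1 := by positivity
    have h20 : 0 ≤ 3840 * Af * (8 * L * c₃ * (1 + Bf) + (4 * Bf + 1) * s₁ * π / 2) / (cf ^ 2 * s₁ ^ 2 * π ^ 2) := by positivity
    calc (16 * L * c₃ / (s₁ * π) + 1) * (3840 * Af * (8 * L * c₃ * (1 + Bf) + (4 * Bf + 1) * s₁ * π / 2) / (cf ^ 2 * s₁ ^ 2 * π ^ 2) * t)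
        = (16 * L * c₃ / (s₁ * π) + 1) * (3840 * Af * (8 * L * c₃ * (1 + Bf) + (4 * Bf + 1) * s₁ * π / 2) / (cf ^ 2 * s₁ ^ 2 * π ^ 2)) * t := by
          ring
      _ ≤ ((16 * c₃ / (s₁ * π) + 1) * L) * (3840 * Af * (8 * c₃ * (1 + Bf) + (4 * Bf + 1) * s₁ * π / 2) / (cf ^ 2 * s₁ ^ 2 * π ^ 2) * L) * t :=
          mul_le_mul_of_nonneg_right (mul_le_mul h1 h2 h20 (by positivity)) ht0.le
      _ = E₁ * (L : ℝ) ^ 2 * t := by rw [hE₁]; ring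
  have hE0 : 0 ≤ (16 * L * c₃ / (s₁ * π) + 1) * (3840 * Af * (8 * L * c₃ * (1 + Bf) + (4 * Bf + 1) * s₁ * π / 2) / (cf ^ 2 * s₁ ^ 2 * π ^ 2) * t) := by
    positivity
  -- powers of `t` and of `L`
  have htpow : t * t * t ^ (L - (F + 4)) = t ^ (L - F - 2) := by
    rw [← pow_two, ← pow_add]; congr 1; omega
  have ht3 : t ^ (L - F - 2) = (2 : ℝ) ^ (n' * (L - F - 2)) := by rw [ht, ← pow_mul]
  have hL6 := natCast_pow_six_le L
  have hΦpow : (2 * (Φ₀ + 1)) ^ (L - (F + 4)) ≤ (2 * (Φ₀ + 1)) ^ L := pow_le_pow_right₀ (by linarith) (by omega)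
  have h3pow : (3 : ℝ) ^ (L - F - 2) ≤ (3 : ℝ) ^ L := pow_le_pow_right₀ (by norm_num) (by omega)
  have hLone : 1 ≤ L := by omega
  -- the narrow term
  have hnarrow : 2 * (L : ℝ) ^ 4 * ((16 * L * c₃ / (s₁ * π) + 1) *
        (3840 * Af * (8 * L * c₃ * (1 + Bf) + (4 * Bf + 1) * s₁ * π / 2) / (cf ^ 2 * s₁ ^ 2 * π ^ 2) * t) * (2 * t * K ^ (L - (F + 4)))) ≤
      (128 * (Φ₀ + 1) * (4 * E₁ + 1)) ^ L * t ^ (L - F - 2) := by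
    calc 2 * (L : ℝ) ^ 4 * ((16 * L * c₃ / (s₁ * π) + 1) *
          (3840 * Af * (8 * L * c₃ * (1 + Bf) + (4 * Bf + 1) * s₁ * π / 2) / (cf ^ 2 * s₁ ^ 2 * π ^ 2) * t) * (2 * t * K ^ (L - (F + 4))))
        ≤ 2 * (L : ℝ) ^ 4 * ((E₁ * (L : ℝ) ^ 2 * t) * (2 * t * ((2 * (Φ₀ + 1)) ^ (L - (F + 4)) * t ^ (L - (F + 4))))) := by
          refine mul_le_mul_of_nonneg_left (mul_le_mul hEL (mul_le_mul_of_nonneg_left hKpow (by positivity)) (by positivity)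
            (by positivity)) (by positivity)
      _ = 4 * E₁ * (L : ℝ) ^ 6 * (2 * (Φ₀ + 1)) ^ (L - (F + 4)) * (t * t * t ^ (L - (F + 4))) := by ring
      _ = 4 * E₁ * (L : ℝ) ^ 6 * (2 * (Φ₀ + 1)) ^ (L - (F + 4)) * t ^ (L - F - 2) := by rw [htpow]
      _ ≤ 4 * E₁ * (64 : ℝ) ^ L * (2 * (Φ₀ + 1)) ^ L * t ^ (L - F - 2) := by
          have h1 : 4 * E₁ * (L : ℝ) ^ 6 ≤ 4 * E₁ * (64 : ℝ) ^ L := mul_le_mul_of_nonneg_left hL6 (by positivity)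
          have h2 : 4 * E₁ * (L : ℝ) ^ 6 * (2 * (Φ₀ + 1)) ^ (L - (F + 4)) ≤ 4 * E₁ * (64 : ℝ) ^ L * (2 * (Φ₀ + 1)) ^ L :=
            mul_le_mul h1 hΦpow (by positivity) (by positivity)
          exact mul_le_mul_of_nonneg_right h2 (by positivity)
      _ ≤ (4 * E₁ + 1) ^ L * ((64 : ℝ) ^ L * (2 * (Φ₀ + 1)) ^ L) * t ^ (L - F - 2) := by
          rw [show 4 * E₁ * (64 : ℝ) ^ L * (2 * (Φ₀ + 1)) ^ L = 4 * E₁ * ((64 : ℝ) ^ L * (2 * (Φ₀ + 1)) ^ L) by ring]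
          exact mul_le_mul_of_nonneg_right (mul_le_mul_of_nonneg_right (le_add_one_pow (by positivity) hLone) (by positivity))
            (by positivity)
      _ = (128 * (Φ₀ + 1) * (4 * E₁ + 1)) ^ L * t ^ (L - F - 2) := by
          rw [← mul_pow, ← mul_pow]; congr 2; ring
  -- the wide term
  have hwide : (L : ℝ) ^ 2 * 2 ^ L * (L ^ 2 * (Bfib * (3 * t) ^ (L - F - 2))) ≤ (384 * (a₆ + 1)) ^ L * t ^ (L - F - 2) := by
    calc (L : ℝ) ^ 2 * 2 ^ L * (L ^ 2 * (Bfib * (3 * t) ^ (L - F - 2)))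
        = (L : ℝ) ^ 4 * Bfib * (2 ^ L * 3 ^ (L - F - 2)) * t ^ (L - F - 2) := by rw [mul_pow]; ring
      _ ≤ (L : ℝ) ^ 4 * (a₆ * (L : ℝ) ^ 2) * (2 ^ L * 3 ^ L) * t ^ (L - F - 2) := by
          have h1 : (L : ℝ) ^ 4 * Bfib ≤ (L : ℝ) ^ 4 * (a₆ * (L : ℝ) ^ 2) := mul_le_mul_of_nonneg_left hBfib (by positivity)
          have h2 : (2 : ℝ) ^ L * 3 ^ (L - F - 2) ≤ 2 ^ L * 3 ^ L := mul_le_mul_of_nonneg_left h3pow (by positivity)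
          exact mul_le_mul_of_nonneg_right (mul_le_mul h1 h2 (by positivity) (by positivity)) (by positivity)
      _ = a₆ * (L : ℝ) ^ 6 * (6 : ℝ) ^ L * t ^ (L - F - 2) := by
          have h6 : (2 : ℝ) ^ L * 3 ^ L = 6 ^ L := by rw [← mul_pow]; norm_num
          rw [h6]; ring
      _ ≤ a₆ * (64 : ℝ) ^ L * (6 : ℝ) ^ L * t ^ (L - F - 2) := by
          have h1 : a₆ * (L : ℝ) ^ 6 ≤ a₆ * (64 : ℝ) ^ L := mul_le_mul_of_nonneg_left hL6 ha₆
          exact mul_le_mul_of_nonneg_right (mul_le_mul_of_nonneg_right h1 (by positivity)) (by positivity)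
      _ ≤ (a₆ + 1) ^ L * ((64 : ℝ) ^ L * (6 : ℝ) ^ L) * t ^ (L - F - 2) := by
          rw [show a₆ * (64 : ℝ) ^ L * (6 : ℝ) ^ L = a₆ * ((64 : ℝ) ^ L * (6 : ℝ) ^ L) by ring]
          exact mul_le_mul_of_nonneg_right (mul_le_mul_of_nonneg_right (le_add_one_pow ha₆ hLone) (by positivity)) (by positivity)
      _ = (384 * (a₆ + 1)) ^ L * t ^ (L - F - 2) := by
          rw [← mul_pow, ← mul_pow]; congr 2; ring
  -- sum
  have hsum : (128 * (Φ₀ + 1) * (4 * E₁ + 1)) ^ L * t ^ (L - F - 2) + (384 * (a₆ + 1)) ^ L * t ^ (L - F - 2) ≤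
      (128 * (Φ₀ + 1) * (4 * E₁ + 1) + 384 * (a₆ + 1)) ^ L * t ^ (L - F - 2) := by
    rw [← add_mul]
    refine mul_le_mul_of_nonneg_right (pow_add_pow_le (by positivity) (by positivity) (by omega)) (by positivity)
  rw [← ht3]
  exact (add_le_add hnarrow hwide).trans hsum

end Summit.HubbardSuperconductivity.HubbardSuperconductivity.Theorems.AbsUmklappCount

end
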